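import Summits.QuantumFields.YangMills.Theorems.UnitScaleTiltProp7CurvedLandauCoercivity
import HarnessLib

/-!
# Route `UnitScaleTilt`, crux K1 child «MinimiserStabilityRegPr» (stmt-QuantumFields-19200), route-R GROWTH (MAP #3 M10, S3 «nonlinear passage»), brick (c) —
# THE RELATIVE PLAQUETTE VARIABLE AGAINST THE COVARIANT CURL IN `ℓ²` AT THE d = 3 CARRIER: `18·Σ‖D_{U₀}Y‖²_HS ≤ 72·Σ_p‖R_p − 1‖² + (442368·s² + 13824·a²)·Σ_b‖Y_b‖²`,
# and the passage from S2′'s Landau-slice coercivity to the (ii′)-shape `Σ‖Y‖² ≲ L^{2(K−n)}·Σ_p‖R_p − 1‖²` modulo the curved-N6 structure rows — k-UNIFORM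

Cell `ym3-torus`, width seat `ym-ust-19200-w4` (gen 2; free-hand CLAIM 2026-08-28 04:17Z under MAP #3's «row done ⇒ next un-held row» rule — routeR-w3 (M10) not signed in;
★p1 g11 RULING (P)∕(Λ) 03:35:54Z: curved engine of record = S2′ on the Landau slice, `Prop7CurvedLandauCoercivity.sum_normSq_le_curl_sq_of_landau_of_structure_T3` ✓ p601741).
THEOREMS ONLY (0 `def`, 0 `sorry`).  YM₃ on T³ is a ladder rung (R3), not the Clay problem; nothing here claims the stub, the crux, d = 4 or the mass gap.

WHY AND WHAT (numbers).  The engines (p483802, S2′) deliver coercivity in the Hilbert–Schmidt CURL currency `Σ_{x,μ<ν}‖(D_{U₀}Y)(p_{μν}(x))‖²_HS`; the growth row (ii′) of `growth142_T3`∕`hrepr`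
reads the RELATIVE PLAQUETTE currency `Σ_p‖R_p − 1‖²`, `R_p = U(∂p)U₀(∂p)^*` (operator norm).  Per plaquette the two differ at second order (p1's
`Prop7CovariantCoercivity.norm_plaqHol_mul_star_bg_sub_one_sub_covCurl_le`: `‖R_p − 1 − L_p(Y)‖ ≤ 2σ_p² + 2a(‖Y₃‖+‖Y₄‖)`, `σ_p = Σ_{∂p}‖Y‖`, and `L_p(Y)` IS the covariant
curl by `curl_bg_eq`).  The k-UNIFORM way to sum this is through SQUARES, not the cross term: `‖L_p‖²_HS ≤ 2‖L_p‖² ≤ 4‖R_p − 1‖² + 4r_p²`, `r_p² ≤ (512s² + 16a²)·Σ_{∂p}‖Y‖²`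
(`‖Y_b‖ ≤ s ≤ 1`), incidence `4d = 12`: **`Σ‖curl‖²_HS ≤ 4Σ_p‖R_p − 1‖² + (24576s² + 768a²)Σ_b‖Y_b‖²`** — with `s = ε₂L^{−(K−n)}`, `a = εL^{−2(K−n)}` the loss is
`O(ε₂²)·L^{−2(K−n)}·Σ‖Y‖²`, absorbable by the `L^{−2(K−n)}` gain (the cross-term route costs `s·Σ‖Y‖²` and is NOT k-uniform — located).  §3 is the passage: S2′'s hypotheses
VERBATIM at `Y := UU₀^* − 1` plus the sup radius ⟹ `((1 − 32c_Eε²)·L^{−2(K−n)} − 442368s² − 13824ε²L^{−4(K−n)})·Σ_b‖Y_b‖² ≤ 72·Σ_p‖R_p − 1‖² + 384c_Λ·G` — the (ii′)-SHAPE on the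
Landau slice modulo the structure rows (bricks (a) point-Landau `D^*Y = O(Y²)` and (b) the `Q^{(k)}`-defect are routeR-w3's and not claimed).

WHAT IS PROVED (ns `…Theorems.Prop7RelPlaqVsCovCurl`).  §1 `remainder_sq_le` (the arithmetic of `r_p²`), `hs_chain_le`, `hs_covCurl_le` (per plaquette, `SU(2)`); §2 ★ `sum_hs_curl_le_relPlaq_T3`
(summed at the d = 3 carrier through `sum_plaq_eq_sum_ite` ∘ `curl_bg_eq`); §3 ★★ `relPoincare_of_landau_of_structure_T3` (the passage ∘ S2′).

HONEST SCOPE.  Bookkeeping over p1's plaquette expansion and S2′; the structure rows (curved N6) and the Landau∕sup hypotheses stay DISPLAYED; nothing of [Balaban1985Variational] ∕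
[Balaban1985BackgroundPropagators] is asserted; `--supports stmt-QuantumFields-19200`, count-neutral.

References: T. Bałaban, CMP 102 (1985) 277–309 [Balaban1985Variational] ((22)–(28) pp.281–282, (141)–(143) p.299); CMP 99 (1985) 389–434 [Balaban1985BackgroundPropagators]
((3.3)–(3.4) pp.390–391, Thm 3.11 p.416).
-/

set_option autoImplicit false

noncomputable section

open scoped BigOperators Matrix.Norms.L2Operator Matrix

namespace Summit.QuantumFields.YangMills.Theorems.Prop7RelPlaqVsCovCurl

open Literature.MathematicalPhysics.QuantumFieldTheory.Balaban1983to89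
open Literature.MathematicalPhysics.QuantumFieldTheory.Balaban1983to89.T3ContinuumYM3Torus
open Finset B1RG242Torus
open B7Prop1Explicit (treeWord)
open B7Eq78Linearization (conjR)
open B9Eq39Adjoint (curl divB)
open B10Eq27TorusAxialLog (holT unitsField toUField)
open B9TorusCalculus (torusT)
open Summit.QuantumFields.YangMills.Theorems.Prop7CovariantCoercivity (norm_plaqHol_mul_star_bg_sub_one_sub_covCurl_le curl_bg_eq sum_plaq_eq_sum_ite
  sum_norm_sq_le_mul_opNorm_sq)
open Summit.QuantumFields.YangMills.Theorems.Prop7FlatLocalMin (sum_plaq_bonds_le)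
open Summit.QuantumFields.YangMills.Theorems.Prop7CurvedLandauCoercivity (sum_normSq_le_curl_sq_of_landau_of_structure_T3)

/-! ## §1 Per plaquette: the Hilbert–Schmidt size of the covariant curl against the relative plaquette variable -/

/-- The arithmetic of the squared remainder: for `0 ≤ y_i ≤ s ≤ 1`, `0 ≤ a`: `(2(Σy)² + 2a(y₃ + y₄))² ≤ (512s² + 16a²)·Σy_i²` (any real `a`). [folklore] -/
theorem remainder_sq_le {y₁ y₂ y₃ y₄ s a : ℝ} (h₁ : 0 ≤ y₁) (h₂ : 0 ≤ y₂) (h₃ : 0 ≤ y₃) (h₄ : 0 ≤ y₄)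
    (hs₁ : y₁ ≤ s) (hs₂ : y₂ ≤ s) (hs₃ : y₃ ≤ s) (hs₄ : y₄ ≤ s) :
    (2 * (y₁ + y₂ + y₃ + y₄) ^ 2 + 2 * a * (y₃ + y₄)) ^ 2 ≤ (512 * s ^ 2 + 16 * a ^ 2) * (y₁ ^ 2 + y₂ ^ 2 + y₃ ^ 2 + y₄ ^ 2) := by
  set σ := y₁ + y₂ + y₃ + y₄ with hσ
  have hσ0 : 0 ≤ σ := by positivity
  have hσs : σ ≤ 4 * s := by linarith
  have hcs : σ ^ 2 ≤ 4 * (y₁ ^ 2 + y₂ ^ 2 + y₃ ^ 2 + y₄ ^ 2) := by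
    nlinarith [sq_nonneg (y₁ - y₂), sq_nonneg (y₁ - y₃), sq_nonneg (y₁ - y₄), sq_nonneg (y₂ - y₃), sq_nonneg (y₂ - y₄), sq_nonneg (y₃ - y₄)]
  have h34 : (y₃ + y₄) ^ 2 ≤ 2 * (y₁ ^ 2 + y₂ ^ 2 + y₃ ^ 2 + y₄ ^ 2) := by nlinarith [sq_nonneg (y₃ - y₄)]
  -- `(A + B)² ≤ 2A² + 2B²`
  have hsplit : (2 * σ ^ 2 + 2 * a * (y₃ + y₄)) ^ 2 ≤ 8 * σ ^ 4 + 8 * (a * (y₃ + y₄)) ^ 2 := by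
    nlinarith [sq_nonneg (2 * σ ^ 2 - 2 * a * (y₃ + y₄))]
  have hσ4 : σ ^ 4 ≤ 16 * s ^ 2 * σ ^ 2 := by
    have : σ ^ 2 ≤ (4 * s) ^ 2 := pow_le_pow_left₀ hσ0 hσs 2
    nlinarith [sq_nonneg σ]
  have hS0 : 0 ≤ y₁ ^ 2 + y₂ ^ 2 + y₃ ^ 2 + y₄ ^ 2 := by positivity
  have h_a : a ^ 2 * (y₃ + y₄) ^ 2 ≤ a ^ 2 * (2 * (y₁ ^ 2 + y₂ ^ 2 + y₃ ^ 2 + y₄ ^ 2)) := mul_le_mul_of_nonneg_left h34 (sq_nonneg a)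
  have h_s : 16 * s ^ 2 * σ ^ 2 ≤ 16 * s ^ 2 * (4 * (y₁ ^ 2 + y₂ ^ 2 + y₃ ^ 2 + y₄ ^ 2)) := mul_le_mul_of_nonneg_left hcs (by positivity)
  have e : (a * (y₃ + y₄)) ^ 2 = a ^ 2 * (y₃ + y₄) ^ 2 := by ring
  rw [e] at hsplit
  linarith [hsplit, hσ4, h_a, h_s]

/-- The real chain behind the per-plaquette bound: `HS ≤ 2l²`, `l ≤ r + ρ`, `ρ ≤ B`, `B² ≤ C·T` ⟹ `HS ≤ 4r² + 4·(C·T)`. [folklore] -/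
theorem hs_chain_le {HS l r ρ B CT : ℝ} (hl : 0 ≤ l) (hρ : 0 ≤ ρ) (hHS : HS ≤ 2 * l ^ 2) (htri : l ≤ r + ρ) (hρB : ρ ≤ B) (hB : B ^ 2 ≤ CT) :
    HS ≤ 4 * r ^ 2 + 4 * CT := by
  have h1 : l ≤ r + B := htri.trans (by linarith)
  have hB0 : 0 ≤ B := hρ.trans hρB
  have h2 : l ^ 2 ≤ (r + B) ^ 2 := pow_le_pow_left₀ hl h1 2
  nlinarith [h2, sq_nonneg (r - B)]

variable {P : Params} {j : ℕ}

/-- **THE COVARIANT CURL OF A FLUCTUATION AGAINST ITS RELATIVE PLAQUETTE VARIABLE, PER PLAQUETTE, IN HILBERT–SCHMIDT SIZE** (`SU(2)`): for `Y(b) = U(b)U₀(b)^* − 1` with `‖Y(b)‖ ≤ s ≤ 1`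
on `∂p` and `‖U₀(∂p) − 1‖ ≤ a`: `Σ_jk|(L_p(Y))_jk|² ≤ 4‖R_p − 1‖² + (512s² + 16a²)·4·…` — precisely `≤ 4‖R_p − 1‖² + 4·(512s² + 16a²)·Σ_{b∈∂p}‖Y(b)‖²`, `L_p(Y)` the
covariant curl `Y(b₁) + U₀(b₁)Y(b₂)U₀(b₁)^* − U₀(b₄)Y(b₃)U₀(b₄)^* − Y(b₄)`. [cite: Balaban1985Variational, (22)-(28) pp.281-282; Balaban1985BackgroundPropagators, (3.4) p.391] -/
theorem hs_covCurl_le (U U₀ : GaugeField P j (Matrix.specialUnitaryGroup (Fin 2) ℂ)) (p : Plaq P j) {s a : ℝ}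
    (hs : ‖(U ⟨p.src, p.μ⟩ : Matrix (Fin 2) (Fin 2) ℂ) * star (U₀ ⟨p.src, p.μ⟩ : Matrix (Fin 2) (Fin 2) ℂ) - 1‖ ≤ s ∧ ‖(U ⟨p.src.shift p.μ, p.ν⟩ : Matrix (Fin 2) (Fin 2) ℂ) * star (U₀ ⟨p.src.shift p.μ, p.ν⟩ : Matrix (Fin 2) (Fin 2) ℂ) - 1‖ ≤ s ∧
      ‖(U ⟨p.src.shift p.ν, p.μ⟩ : Matrix (Fin 2) (Fin 2) ℂ) * star (U₀ ⟨p.src.shift p.ν, p.μ⟩ : Matrix (Fin 2) (Fin 2) ℂ) - 1‖ ≤ s ∧ ‖(U ⟨p.src, p.ν⟩ : Matrix (Fin 2) (Fin 2) ℂ) * star (U₀ ⟨p.src, p.ν⟩ : Matrix (Fin 2) (Fin 2) ℂ) - 1‖ ≤ s)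
    (hs1 : s ≤ 1) (hE : ‖((GaugeField.plaqHol U₀ p : Matrix.specialUnitaryGroup (Fin 2) ℂ) : Matrix (Fin 2) (Fin 2) ℂ) - 1‖ ≤ a) :
    ∑ i₁ : Fin 2, ∑ i₂ : Fin 2, ‖(((U ⟨p.src, p.μ⟩ : Matrix (Fin 2) (Fin 2) ℂ) * star (U₀ ⟨p.src, p.μ⟩ : Matrix (Fin 2) (Fin 2) ℂ) - 1)
            + (U₀ ⟨p.src, p.μ⟩ : Matrix (Fin 2) (Fin 2) ℂ) * ((U ⟨p.src.shift p.μ, p.ν⟩ : Matrix (Fin 2) (Fin 2) ℂ) * star (U₀ ⟨p.src.shift p.μ, p.ν⟩ : Matrix (Fin 2) (Fin 2) ℂ) - 1) * star (U₀ ⟨p.src, p.μ⟩ : Matrix (Fin 2) (Fin 2) ℂ)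
            - (U₀ ⟨p.src, p.ν⟩ : Matrix (Fin 2) (Fin 2) ℂ) * ((U ⟨p.src.shift p.ν, p.μ⟩ : Matrix (Fin 2) (Fin 2) ℂ) * star (U₀ ⟨p.src.shift p.ν, p.μ⟩ : Matrix (Fin 2) (Fin 2) ℂ) - 1) * star (U₀ ⟨p.src, p.ν⟩ : Matrix (Fin 2) (Fin 2) ℂ)
            - ((U ⟨p.src, p.ν⟩ : Matrix (Fin 2) (Fin 2) ℂ) * star (U₀ ⟨p.src, p.ν⟩ : Matrix (Fin 2) (Fin 2) ℂ) - 1)) i₁ i₂‖ ^ 2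
      ≤ 4 * ‖(((GaugeField.plaqHol U p : Matrix.specialUnitaryGroup (Fin 2) ℂ) : Matrix (Fin 2) (Fin 2) ℂ) * star ((GaugeField.plaqHol U₀ p : Matrix.specialUnitaryGroup (Fin 2) ℂ) : Matrix (Fin 2) (Fin 2) ℂ) - 1)‖ ^ 2
        + 4 * ((512 * s ^ 2 + 16 * a ^ 2) * (‖(U ⟨p.src, p.μ⟩ : Matrix (Fin 2) (Fin 2) ℂ) * star (U₀ ⟨p.src, p.μ⟩ : Matrix (Fin 2) (Fin 2) ℂ) - 1‖ ^ 2 + ‖(U ⟨p.src.shift p.μ, p.ν⟩ : Matrix (Fin 2) (Fin 2) ℂ) * star (U₀ ⟨p.src.shift p.μ, p.ν⟩ : Matrix (Fin 2) (Fin 2) ℂ) - 1‖ ^ 2 + ‖(U ⟨p.src.shift p.ν, p.μ⟩ : Matrix (Fin 2) (Fin 2) ℂ) * star (U₀ ⟨p.src.shift p.ν, p.μ⟩ : Matrix (Fin 2) (Fin 2) ℂ) - 1‖ ^ 2 + ‖(U ⟨p.src, p.ν⟩ : Matrix (Fin 2) (Fin 2) ℂ) * star (U₀ ⟨p.src, p.ν⟩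 : Matrix (Fin 2) (Fin 2) ℂ) - 1‖ ^ 2)) := by
  obtain ⟨hs₁, hs₂, hs₃, hs₄⟩ := hs
  have he0 : 0 ≤ ‖((GaugeField.plaqHol U₀ p : Matrix.specialUnitaryGroup (Fin 2) ℂ) : Matrix (Fin 2) (Fin 2) ℂ) - 1‖ := norm_nonneg _
  -- the second-order remainder per plaquette (p1), with the background's own plaquette radius
  have hr := norm_plaqHol_mul_star_bg_sub_one_sub_covCurl_le U U₀ p (hs₁.trans hs1) (hs₃.trans hs1)
  -- HS ≤ 2·op² on `M₂(ℂ)`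
  have hHS := sum_norm_sq_le_mul_opNorm_sq (((U ⟨p.src, p.μ⟩ : Matrix (Fin 2) (Fin 2) ℂ) * star (U₀ ⟨p.src, p.μ⟩ : Matrix (Fin 2) (Fin 2) ℂ) - 1)
            + (U₀ ⟨p.src, p.μ⟩ : Matrix (Fin 2) (Fin 2) ℂ) * ((U ⟨p.src.shift p.μ, p.ν⟩ : Matrix (Fin 2) (Fin 2) ℂ) * star (U₀ ⟨p.src.shift p.μ, p.ν⟩ : Matrix (Fin 2) (Fin 2) ℂ) - 1) * star (U₀ ⟨p.src, p.μ⟩ : Matrix (Fin 2) (Fin 2) ℂ)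
            - (U₀ ⟨p.src, p.ν⟩ : Matrix (Fin 2) (Fin 2) ℂ) * ((U ⟨p.src.shift p.ν, p.μ⟩ : Matrix (Fin 2) (Fin 2) ℂ) * star (U₀ ⟨p.src.shift p.ν, p.μ⟩ : Matrix (Fin 2) (Fin 2) ℂ) - 1) * star (U₀ ⟨p.src, p.ν⟩ : Matrix (Fin 2) (Fin 2) ℂ)
            - ((U ⟨p.src, p.ν⟩ : Matrix (Fin 2) (Fin 2) ℂ) * star (U₀ ⟨p.src, p.ν⟩ : Matrix (Fin 2) (Fin 2) ℂ) - 1))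
  push_cast at hHS
  -- `‖L‖ ≤ ‖R − 1‖ + ‖(R − 1) − L‖`
  have htri : ‖(((U ⟨p.src, p.μ⟩ : Matrix (Fin 2) (Fin 2) ℂ) * star (U₀ ⟨p.src, p.μ⟩ : Matrix (Fin 2) (Fin 2) ℂ) - 1)
            + (U₀ ⟨p.src, p.μ⟩ : Matrix (Fin 2) (Fin 2) ℂ) * ((U ⟨p.src.shift p.μ, p.ν⟩ : Matrix (Fin 2) (Fin 2) ℂ) * star (U₀ ⟨p.src.shift p.μ, p.ν⟩ : Matrix (Fin 2) (Fin 2) ℂ) - 1) * star (U₀ ⟨p.src, p.μ⟩ : Matrix (Fin 2) (Fin 2) ℂ)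
            - (U₀ ⟨p.src, p.ν⟩ : Matrix (Fin 2) (Fin 2) ℂ) * ((U ⟨p.src.shift p.ν, p.μ⟩ : Matrix (Fin 2) (Fin 2) ℂ) * star (U₀ ⟨p.src.shift p.ν, p.μ⟩ : Matrix (Fin 2) (Fin 2) ℂ) - 1) * star (U₀ ⟨p.src, p.ν⟩ : Matrix (Fin 2) (Fin 2) ℂ)
            - ((U ⟨p.src, p.ν⟩ : Matrix (Fin 2) (Fin 2) ℂ) * star (U₀ ⟨p.src, p.ν⟩ : Matrix (Fin 2) (Fin 2) ℂ) - 1))‖ ≤ ‖(((GaugeField.plaqHol U p : Matrix.specialUnitaryGroup (Fin 2) ℂ) : Matrix (Fin 2) (Fin 2) ℂ) * star ((GaugeField.plaqHol U₀ p : Matrix.specialUnitaryGroup (Fin 2) ℂ) : Matrix (Fin 2) (Fin 2) ℂ) - 1)‖ + ‖(((GaugeField.plaqHol U p : Matrix.specialUnitaryGroup (Fin 2) ℂ) : Matrix (Fin 2) (Fin 2) ℂ) * star ((GaugeField.plaqHol U₀ p : Matrix.specialUnitaryGroup (Fin 2) ℂ) : Matrix (Fin 2) (Fin 2) ℂ)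 - 1)
          - (((U ⟨p.src, p.μ⟩ : Matrix (Fin 2) (Fin 2) ℂ) * star (U₀ ⟨p.src, p.μ⟩ : Matrix (Fin 2) (Fin 2) ℂ) - 1)
            + (U₀ ⟨p.src, p.μ⟩ : Matrix (Fin 2) (Fin 2) ℂ) * ((U ⟨p.src.shift p.μ, p.ν⟩ : Matrix (Fin 2) (Fin 2) ℂ) * star (U₀ ⟨p.src.shift p.μ, p.ν⟩ : Matrix (Fin 2) (Fin 2) ℂ) - 1) * star (U₀ ⟨p.src, p.μ⟩ : Matrix (Fin 2) (Fin 2) ℂ)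
            - (U₀ ⟨p.src, p.ν⟩ : Matrix (Fin 2) (Fin 2) ℂ) * ((U ⟨p.src.shift p.ν, p.μ⟩ : Matrix (Fin 2) (Fin 2) ℂ) * star (U₀ ⟨p.src.shift p.ν, p.μ⟩ : Matrix (Fin 2) (Fin 2) ℂ) - 1) * star (U₀ ⟨p.src, p.ν⟩ : Matrix (Fin 2) (Fin 2) ℂ)
            - ((U ⟨p.src, p.ν⟩ : Matrix (Fin 2) (Fin 2) ℂ) * star (U₀ ⟨p.src, p.ν⟩ : Matrix (Fin 2) (Fin 2) ℂ) - 1))‖ := by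
    have := norm_sub_le (((GaugeField.plaqHol U p : Matrix.specialUnitaryGroup (Fin 2) ℂ) : Matrix (Fin 2) (Fin 2) ℂ) * star ((GaugeField.plaqHol U₀ p : Matrix.specialUnitaryGroup (Fin 2) ℂ) : Matrix (Fin 2) (Fin 2) ℂ) - 1) ((((GaugeField.plaqHol U p : Matrix.specialUnitaryGroup (Fin 2) ℂ) : Matrix (Fin 2) (Fin 2) ℂ) * star ((GaugeField.plaqHol U₀ p : Matrix.specialUnitaryGroup (Fin 2) ℂ) : Matrix (Fin 2) (Fin 2) ℂ) - 1)
          - (((U ⟨p.src, p.μ⟩ : Matrix (Fin 2) (Fin 2) ℂ) * star (U₀ ⟨p.src, p.μ⟩ : Matrix (Fin 2) (Fin 2) ℂ) - 1)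
            + (U₀ ⟨p.src, p.μ⟩ : Matrix (Fin 2) (Fin 2) ℂ) * ((U ⟨p.src.shift p.μ, p.ν⟩ : Matrix (Fin 2) (Fin 2) ℂ) * star (U₀ ⟨p.src.shift p.μ, p.ν⟩ : Matrix (Fin 2) (Fin 2) ℂ) - 1) * star (U₀ ⟨p.src, p.μ⟩ : Matrix (Fin 2) (Fin 2) ℂ)
            - (U₀ ⟨p.src, p.ν⟩ : Matrix (Fin 2) (Fin 2) ℂ) * ((U ⟨p.src.shift p.ν, p.μ⟩ : Matrix (Fin 2) (Fin 2) ℂ) * star (U₀ ⟨p.src.shift p.ν, p.μ⟩ : Matrix (Fin 2) (Fin 2) ℂ) - 1) * star (U₀ ⟨p.src, p.ν⟩ : Matrix (Fin 2) (Fin 2) ℂ)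
            - ((U ⟨p.src, p.ν⟩ : Matrix (Fin 2) (Fin 2) ℂ) * star (U₀ ⟨p.src, p.ν⟩ : Matrix (Fin 2) (Fin 2) ℂ) - 1)))
    rwa [sub_sub_cancel] at this
  have hsq := remainder_sq_le (a := ‖((GaugeField.plaqHol U₀ p : Matrix.specialUnitaryGroup (Fin 2) ℂ) : Matrix (Fin 2) (Fin 2) ℂ) - 1‖)
    (norm_nonneg _) (norm_nonneg _) (norm_nonneg _) (norm_nonneg _) hs₁ hs₂ hs₃ hs₄
  have hT0 : 0 ≤ ‖(U ⟨p.src, p.μ⟩ : Matrix (Fin 2) (Fin 2) ℂ) * star (U₀ ⟨p.src, p.μ⟩ : Matrix (Fin 2) (Fin 2) ℂ) - 1‖ ^ 2 + ‖(U ⟨p.src.shift p.μ, p.ν⟩ : Matrix (Fin 2) (Fin 2) ℂ) * star (U₀ ⟨p.src.shift p.μ, p.ν⟩ : Matrix (Fin 2) (Fin 2) ℂ) - 1‖ ^ 2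
      + ‖(U ⟨p.src.shift p.ν, p.μ⟩ : Matrix (Fin 2) (Fin 2) ℂ) * star (U₀ ⟨p.src.shift p.ν, p.μ⟩ : Matrix (Fin 2) (Fin 2) ℂ) - 1‖ ^ 2 + ‖(U ⟨p.src, p.ν⟩ : Matrix (Fin 2) (Fin 2) ℂ) * star (U₀ ⟨p.src, p.ν⟩ : Matrix (Fin 2) (Fin 2) ℂ) - 1‖ ^ 2 :=
    add_nonneg (add_nonneg (add_nonneg (sq_nonneg _) (sq_nonneg _)) (sq_nonneg _)) (sq_nonneg _)
  have hea : (512 * s ^ 2 + 16 * ‖((GaugeField.plaqHol U₀ p : Matrix.specialUnitaryGroup (Fin 2) ℂ) : Matrix (Fin 2) (Fin 2) ℂ) - 1‖ ^ 2)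
        * (‖(U ⟨p.src, p.μ⟩ : Matrix (Fin 2) (Fin 2) ℂ) * star (U₀ ⟨p.src, p.μ⟩ : Matrix (Fin 2) (Fin 2) ℂ) - 1‖ ^ 2 + ‖(U ⟨p.src.shift p.μ, p.ν⟩ : Matrix (Fin 2) (Fin 2) ℂ) * star (U₀ ⟨p.src.shift p.μ, p.ν⟩ : Matrix (Fin 2) (Fin 2) ℂ) - 1‖ ^ 2
            + ‖(U ⟨p.src.shift p.ν, p.μ⟩ : Matrix (Fin 2) (Fin 2) ℂ) * star (U₀ ⟨p.src.shift p.ν, p.μ⟩ : Matrix (Fin 2) (Fin 2) ℂ) - 1‖ ^ 2 + ‖(U ⟨p.src, p.ν⟩ : Matrix (Fin 2) (Fin 2) ℂ) * star (U₀ ⟨p.src, p.ν⟩ : Matrix (Fin 2) (Fin 2) ℂ) - 1‖ ^ 2)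
      ≤ (512 * s ^ 2 + 16 * a ^ 2)
        * (‖(U ⟨p.src, p.μ⟩ : Matrix (Fin 2) (Fin 2) ℂ) * star (U₀ ⟨p.src, p.μ⟩ : Matrix (Fin 2) (Fin 2) ℂ) - 1‖ ^ 2 + ‖(U ⟨p.src.shift p.μ, p.ν⟩ : Matrix (Fin 2) (Fin 2) ℂ) * star (U₀ ⟨p.src.shift p.μ, p.ν⟩ : Matrix (Fin 2) (Fin 2) ℂ) - 1‖ ^ 2
            + ‖(U ⟨p.src.shift p.ν, p.μ⟩ : Matrix (Fin 2) (Fin 2) ℂ) * star (U₀ ⟨p.src.shift p.ν, p.μ⟩ : Matrix (Fin 2) (Fin 2) ℂ) - 1‖ ^ 2 + ‖(U ⟨p.src, p.ν⟩ : Matrix (Fin 2) (Fin 2) ℂ) * star (U₀ ⟨p.src, p.ν⟩ : Matrix (Fin 2) (Fin 2) ℂ) - 1‖ ^ 2) :=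
    mul_le_mul_of_nonneg_right (by have := pow_le_pow_left₀ he0 hE 2; linarith) hT0
  exact hs_chain_le (norm_nonneg _) (norm_nonneg _) hHS htri hr (hsq.trans hea)

/-! ## §2 Summed at the d = 3 carrier -/

/-- ★ **`Σ_{x,μ<ν}‖(D_{U₀}Y)(p_{μν}(x))‖²_HS ≤ 4·Σ_p‖R_p − 1‖² + (24576s² + 768a²)·Σ_b‖Y(b)‖²`** at the d = 3 carrier, for `Y(b) = U(b)U₀(b)^* − 1` with `‖Y(b)‖ ≤ s ≤ 1` and a
background with plaquettes within `a = εL^{−2(K−n)}` of `1` — the engine's curl currency against the relative-plaquette currency of (ii′), k-UNIFORM (squares, incidence `4d = 12`).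
[cite: Balaban1985Variational, (22)-(28) pp.281-282; Balaban1985BackgroundPropagators, (3.3)-(3.4) pp.390-391] -/
theorem sum_hs_curl_le_relPlaq_T3 (F : T3Family) (n K : ℕ) (U U₀ : GaugeField (F.P K) 0 (Matrix.specialUnitaryGroup (Fin 2) ℂ)) {ε s : ℝ}
    (hU₀ : ∀ p : Plaq (F.P K) 0, dist1 (GaugeField.plaqHol U₀ p) ≤ ε * (((F.L : ℝ) ^ (K - n)) ^ 2)⁻¹)
    (hδ : ∀ b : PBond (F.P K) 0, ‖(U b : Matrix (Fin 2) (Fin 2) ℂ) * star (U₀ b : Matrix (Fin 2) (Fin 2) ℂ) - 1‖ ≤ s) (hs1 : s ≤ 1) :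
    ∑ x : Site (F.P K) 0, ∑ μ : Fin (F.P K).d, ∑ ν : Fin (F.P K).d,
            (if μ < ν then ∑ j : Fin 2, ∑ k : Fin 2,
              ‖(curl (torusT (F.P K) 0) (fun κ z => unitsField (toUField U₀) ⟨z, κ⟩)
                (fun κ z => (U ⟨z, κ⟩ : Matrix (Fin 2) (Fin 2) ℂ) * star (U₀ ⟨z, κ⟩ : Matrix (Fin 2) (Fin 2) ℂ) - 1) μ ν x) j k‖ ^ 2 else 0)
      ≤ 4 * ∑ p : Plaq (F.P K) 0, ‖((GaugeField.plaqHol U p : Matrix.specialUnitaryGroup (Fin 2) ℂ) : Matrix (Fin 2) (Fin 2) ℂ) * star ((GaugeField.plaqHol U₀ p : Matrix.specialUnitaryGroup (Fin 2) ℂ) : Matrix (Fin 2) (Fin 2) ℂ) - 1‖ ^ 2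
        + (24576 * s ^ 2 + 768 * (ε * (((F.L : ℝ) ^ (K - n)) ^ 2)⁻¹) ^ 2) * ∑ b : PBond (F.P K) 0, ‖(U b : Matrix (Fin 2) (Fin 2) ℂ) * star (U₀ b : Matrix (Fin 2) (Fin 2) ℂ) - 1‖ ^ 2 := by
  set a : ℝ := ε * (((F.L : ℝ) ^ (K - n)) ^ 2)⁻¹ with ha_def
  -- the curl sum IS the sum over plaquettes of the transported linear parts (p1's dictionary)
  have hcurl : ∑ x : Site (F.P K) 0, ∑ μ : Fin (F.P K).d, ∑ ν : Fin (F.P K).d,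
            (if μ < ν then ∑ j : Fin 2, ∑ k : Fin 2,
              ‖(curl (torusT (F.P K) 0) (fun κ z => unitsField (toUField U₀) ⟨z, κ⟩)
                (fun κ z => (U ⟨z, κ⟩ : Matrix (Fin 2) (Fin 2) ℂ) * star (U₀ ⟨z, κ⟩ : Matrix (Fin 2) (Fin 2) ℂ) - 1) μ ν x) j k‖ ^ 2 else 0)
      = ∑ p : Plaq (F.P K) 0, ∑ i₁ : Fin 2, ∑ i₂ : Fin 2, ‖(((U ⟨p.src, p.μ⟩ : Matrix (Fin 2) (Fin 2) ℂ) * star (U₀ ⟨p.src, p.μ⟩ : Matrix (Fin 2) (Fin 2) ℂ) - 1)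
            + (U₀ ⟨p.src, p.μ⟩ : Matrix (Fin 2) (Fin 2) ℂ) * ((U ⟨p.src.shift p.μ, p.ν⟩ : Matrix (Fin 2) (Fin 2) ℂ) * star (U₀ ⟨p.src.shift p.μ, p.ν⟩ : Matrix (Fin 2) (Fin 2) ℂ) - 1) * star (U₀ ⟨p.src, p.μ⟩ : Matrix (Fin 2) (Fin 2) ℂ)
            - (U₀ ⟨p.src, p.ν⟩ : Matrix (Fin 2) (Fin 2) ℂ) * ((U ⟨p.src.shift p.ν, p.μ⟩ : Matrix (Fin 2) (Fin 2) ℂ) * star (U₀ ⟨p.src.shift p.ν, p.μ⟩ : Matrix (Fin 2) (Fin 2) ℂ) - 1) * star (U₀ ⟨p.src, p.ν⟩ : Matrix (Fin 2) (Fin 2) ℂ)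
            - ((U ⟨p.src, p.ν⟩ : Matrix (Fin 2) (Fin 2) ℂ) * star (U₀ ⟨p.src, p.ν⟩ : Matrix (Fin 2) (Fin 2) ℂ) - 1)) i₁ i₂‖ ^ 2 := by
    rw [← sum_plaq_eq_sum_ite (fun x μ ν => ∑ i₁ : Fin 2, ∑ i₂ : Fin 2,
      ‖(curl (torusT (F.P K) 0) (fun κ z => unitsField (toUField U₀) ⟨z, κ⟩)
        (fun κ z => (U ⟨z, κ⟩ : Matrix (Fin 2) (Fin 2) ℂ) * star (U₀ ⟨z, κ⟩ : Matrix (Fin 2) (Fin 2) ℂ) - 1) μ ν x) i₁ i₂‖ ^ 2)]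
    refine Finset.sum_congr rfl fun p _ => ?_
    rw [curl_bg_eq U₀ (fun b => (U b : Matrix (Fin 2) (Fin 2) ℂ) * star (U₀ b : Matrix (Fin 2) (Fin 2) ℂ) - 1) p]
  rw [hcurl]
  -- per plaquette, then the incidence
  have hper : ∀ p : Plaq (F.P K) 0, ∑ i₁ : Fin 2, ∑ i₂ : Fin 2, ‖(((U ⟨p.src, p.μ⟩ : Matrix (Fin 2) (Fin 2) ℂ) * star (U₀ ⟨p.src, p.μ⟩ : Matrix (Fin 2) (Fin 2) ℂ) - 1)
            + (U₀ ⟨p.src, p.μ⟩ : Matrix (Fin 2) (Fin 2) ℂ) * ((U ⟨p.src.shift p.μ, p.ν⟩ : Matrix (Fin 2) (Fin 2) ℂ) * star (U₀ ⟨p.src.shift p.μ, p.ν⟩ : Matrix (Fin 2) (Fin 2) ℂ) - 1) * star (U₀ ⟨p.src, p.μ⟩ : Matrix (Fin 2) (Fin 2) ℂ)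
            - (U₀ ⟨p.src, p.ν⟩ : Matrix (Fin 2) (Fin 2) ℂ) * ((U ⟨p.src.shift p.ν, p.μ⟩ : Matrix (Fin 2) (Fin 2) ℂ) * star (U₀ ⟨p.src.shift p.ν, p.μ⟩ : Matrix (Fin 2) (Fin 2) ℂ) - 1) * star (U₀ ⟨p.src, p.ν⟩ : Matrix (Fin 2) (Fin 2) ℂ)
            - ((U ⟨p.src, p.ν⟩ : Matrix (Fin 2) (Fin 2) ℂ) * star (U₀ ⟨p.src, p.ν⟩ : Matrix (Fin 2) (Fin 2) ℂ) - 1)) i₁ i₂‖ ^ 2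
      ≤ 4 * ‖(((GaugeField.plaqHol U p : Matrix.specialUnitaryGroup (Fin 2) ℂ) : Matrix (Fin 2) (Fin 2) ℂ) * star ((GaugeField.plaqHol U₀ p : Matrix.specialUnitaryGroup (Fin 2) ℂ) : Matrix (Fin 2) (Fin 2) ℂ) - 1)‖ ^ 2
        + 4 * ((512 * s ^ 2 + 16 * a ^ 2) * (‖(U ⟨p.src, p.μ⟩ : Matrix (Fin 2) (Fin 2) ℂ) * star (U₀ ⟨p.src, p.μ⟩ : Matrix (Fin 2) (Fin 2) ℂ) - 1‖ ^ 2 + ‖(U ⟨p.src.shift p.μ, p.ν⟩ : Matrix (Fin 2) (Fin 2) ℂ) * star (U₀ ⟨p.src.shift p.μ, p.ν⟩ : Matrix (Fin 2) (Fin 2) ℂ) - 1‖ ^ 2 + ‖(U ⟨p.src.shift p.ν, p.μ⟩ : Matrix (Fin 2) (Fin 2) ℂ) * star (U₀ ⟨p.src.shift p.ν, p.μ⟩ : Matrix (Fin 2) (Fin 2) ℂ) - 1‖ ^ 2 + ‖(U ⟨p.src, p.ν⟩ : Matrix (Fin 2) (Fin 2) ℂ) * star (U₀ ⟨p.src, p.ν⟩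 : Matrix (Fin 2) (Fin 2) ℂ) - 1‖ ^ 2)) :=
    fun p => hs_covCurl_le U U₀ p ⟨hδ _, hδ _, hδ _, hδ _⟩ hs1 (hU₀ p)
  have hsum := Finset.sum_le_sum fun p (_ : p ∈ (Finset.univ : Finset (Plaq (F.P K) 0))) => hper p
  have hinc := sum_plaq_bonds_le (P := F.P K) (j := 0) (fun b => ‖(U b : Matrix (Fin 2) (Fin 2) ℂ) * star (U₀ b : Matrix (Fin 2) (Fin 2) ℂ) - 1‖ ^ 2) (fun b => sq_nonneg _)
  have hd : ((F.P K).d : ℝ) = 3 := by norm_num [T3Family.P_d]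
  rw [hd] at hinc
  have hc0 : 0 ≤ 4 * (512 * s ^ 2 + 16 * a ^ 2) := by positivity
  simp only [Finset.sum_add_distrib] at hinc
  have herr := mul_le_mul_of_nonneg_left hinc hc0
  simp only [Finset.sum_add_distrib, ← Finset.mul_sum] at hsum
  have hS0 : 0 ≤ ∑ b : PBond (F.P K) 0, ‖(U b : Matrix (Fin 2) (Fin 2) ℂ) * star (U₀ b : Matrix (Fin 2) (Fin 2) ℂ) - 1‖ ^ 2 :=
    Finset.sum_nonneg fun _ _ => sq_nonneg _
  nlinarith [hsum, herr, hS0]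

/-! ## §3 ★★ The passage: S2′'s Landau-slice coercivity in the (ii′) currency -/

/-- ★★ **(ii′)-SHAPE ON THE LANDAU SLICE MODULO THE CURVED-N6 STRUCTURE ROWS** (S3 brick (c) ∘ S2′).  Background `U₀` with plaquettes within `εL^{−2(K−n)}` (`216ε ≤ 1`), competitor
`U` with `Y = UU₀^* − 1` in the covariant Landau gauge, `‖Y(b)‖ ≤ s ≤ 1`; the structure rows (Λ, E, G, c_Λ, c_E) of `Prop7CurvedLandauCoercivity.sum_normSq_le_curl_sq_of_landau_of_structure_T3`
DISPLAYED at this `Y`.  THEN `((1 − 32c_Eε²)·L^{−2(K−n)} − 442368s² − 13824ε²L^{−4(K−n)})·Σ_b‖Y(b)‖² ≤ 72·Σ_p‖R_p − 1‖² + 384c_Λ·G` — with `s = ε₂L^{−(K−n)}` the rate is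
`(1 − 32c_Eε² − 442368ε₂² − 13824ε²L^{−2(K−n)})·L^{−2(K−n)}`, k-UNIFORM. [cite: Balaban1985BackgroundPropagators, Thm 3.11 p.416; Balaban1985Variational, (141)-(143) p.299] -/
theorem relPoincare_of_landau_of_structure_T3 (F : T3Family) (n K : ℕ)
    (U U₀ : GaugeField (F.P K) 0 (Matrix.specialUnitaryGroup (Fin 2) ℂ)) {ε s : ℝ} (hε : 0 ≤ ε) (hε1 : 216 * ε ≤ 1)
    (hU₀ : ∀ p : Plaq (F.P K) 0, dist1 (GaugeField.plaqHol U₀ p) ≤ ε * (((F.L : ℝ) ^ (K - n)) ^ 2)⁻¹)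
    (hδ : ∀ b : PBond (F.P K) 0, ‖(U b : Matrix (Fin 2) (Fin 2) ℂ) * star (U₀ b : Matrix (Fin 2) (Fin 2) ℂ) - 1‖ ≤ s) (hs1 : s ≤ 1)
    (hdiv : ∀ x : Site (F.P K) 0, divB (torusT (F.P K) 0) (fun κ z => unitsField (toUField U₀) ⟨z, κ⟩)
      (fun κ z => (U ⟨z, κ⟩ : Matrix (Fin 2) (Fin 2) ℂ) * star (U₀ ⟨z, κ⟩ : Matrix (Fin 2) (Fin 2) ℂ) - 1) x = 0)
    (Λ : Site (F.P K) (K - n) → Matrix (Fin 2) (Fin 2) ℂ) (E : PBond (F.P K) (K - n) → ℝ) {G cΛ cE : ℝ}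
    (hA : ∀ c : PBond (F.P K) (K - n),
      ‖∑ r : Fin (F.P K).d → Fin ((F.P K).L ^ (K - n)), ∑ t ∈ range ((F.P K).L ^ (K - n)),
        conjR (holT (unitsField (toUField U₀)) (Site.fibreSite 0 (K - n) c.src fun _ => ⟨0, pow_pos (F.P K).L_pos (K - n)⟩)
              (treeWord fun ν => ((r ν : ℕ) : ℤ))
            * holT (unitsField (toUField U₀)) (Site.fibreSite 0 (K - n) c.src r) (List.replicate t (c.dir, true)))
          ((U ⟨(fun z : Site (F.P K) 0 => z.shift c.dir)^[t] (Site.fibreSite 0 (K - n) c.src r), c.dir⟩ : Matrix (Fin 2) (Fin 2) ℂ)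
              * star (U₀ ⟨(fun z : Site (F.P K) 0 => z.shift c.dir)^[t] (Site.fibreSite 0 (K - n) c.src r), c.dir⟩ : Matrix (Fin 2) (Fin 2) ℂ) - 1)‖
        ≤ ((F.L : ℝ) ^ (K - n)) ^ 3 * (‖Λ c.tgt‖ + ‖Λ c.src‖) + E c)
    (hΛ : ∑ y : Site (F.P K) (K - n), ‖Λ y‖ ^ 2 ≤ cΛ * (F.L : ℝ) ^ (K - n) * G)
    (hE : ∑ c : PBond (F.P K) (K - n), E c ^ 2 ≤ cE * ((F.L : ℝ) ^ (K - n)) ^ 5 * ε ^ 2 * ∑ b : PBond (F.P K) 0, ‖(U b : Matrix (Fin 2) (Fin 2) ℂ) * star (U₀ b : Matrix (Fin 2) (Fin 2) ℂ) - 1‖ ^ 2) :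
    ((1 - 32 * cE * ε ^ 2) * (((F.L : ℝ) ^ (K - n)) ^ 2)⁻¹ - 442368 * s ^ 2 - 13824 * (ε * (((F.L : ℝ) ^ (K - n)) ^ 2)⁻¹) ^ 2)
        * ∑ b : PBond (F.P K) 0, ‖(U b : Matrix (Fin 2) (Fin 2) ℂ) * star (U₀ b : Matrix (Fin 2) (Fin 2) ℂ) - 1‖ ^ 2
      ≤ 72 * ∑ p : Plaq (F.P K) 0, ‖((GaugeField.plaqHol U p : Matrix.specialUnitaryGroup (Fin 2) ℂ) : Matrix (Fin 2) (Fin 2) ℂ) * star ((GaugeField.plaqHol U₀ p : Matrix.specialUnitaryGroup (Fin 2) ℂ) : Matrix (Fin 2) (Fin 2) ℂ) - 1‖ ^ 2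
        + 384 * cΛ * G := by
  have hS2 := sum_normSq_le_curl_sq_of_landau_of_structure_T3 F n K U₀ hε hε1 hU₀
    (fun b => (U b : Matrix (Fin 2) (Fin 2) ℂ) * star (U₀ b : Matrix (Fin 2) (Fin 2) ℂ) - 1) hdiv Λ E hA hΛ hE
  have hc := sum_hs_curl_le_relPlaq_T3 F n K U U₀ hU₀ hδ hs1
  have hS0 : 0 ≤ ∑ b : PBond (F.P K) 0, ‖(U b : Matrix (Fin 2) (Fin 2) ℂ) * star (U₀ b : Matrix (Fin 2) (Fin 2) ℂ) - 1‖ ^ 2 := Finset.sum_nonneg fun _ _ => sq_nonneg _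
  nlinarith [hS2, hc, hS0]

end Summit.QuantumFields.YangMills.Theorems.Prop7RelPlaqVsCovCurl

end
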